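import Literature.NumberTheory.Automorphic.SatakeTransformGL
import Literature.NumberTheory.Automorphic.SatakeTransformIwasawa
import HarnessLib

/-!
# The `GL_n` Satake transform is an instance of the abstract Iwasawa-datum transform
# (`satakeTransform hϖ = (isIwasawaExponent_gl hϖ).satakeTransform (q^{-⟨ν, ·⟩})`)

Topic `NumberTheory/Automorphic`; namespace `Literature.NumberTheory.Automorphic` (lane `lit-hodgefound`, Track 2 foundations;
seat `lit-hodgefound-p11`, generation 37, row g37-#8).  Two definitions with bodies (`unipotentTorusGL`, `satakeWeightHom`) +
theorems; no named fact, no instance, no notation.  BRIDGE between the tree's concrete `SatakeTransformGL` (`iwasawaExp`,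
`satakeWeight`, `satakeVec`, `satakeTransform` for `(GL_n(F), GL_n(𝒪))`) and the abstract `SatakeTransformIwasawa`
(`IsIwasawaExponent P K a`, `IsIwasawaExponent.satakeTransform`): the `GL_n` construction is the abstract one for the datum
`P = N·A = {u ϖ^m}`, `K = GL_n(𝒪)`, `a = iwasawaExp`, `w = q^{-⟨ν, ·⟩}` — so every theorem proved for the abstract transform
(double-coset formula, coefficient formula, twists, eigencharacters) applies verbatim to `GL_n`.

## The print

[CartierCorvallis1979] §IV (4.2), Thm. 4.1: `G = PK` with `P = B = AN`, `Sf(m) = δ(m)^{1/2} ∫_N f(mn) dn`; the proof uses only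
`G = NAK` and the multiplicativity of `m ↦ δ(m)^{1/2}` on `A ≅ Λ`.  The tree's `GL_n` file realises exactly this with
`g = u ϖ^{e(g)} k` (`exists_unipotent_mul_zpowDiagGL_mul_glInt`, `zpowDiagGL_unique`) and the integral weight
`q^{-⟨ν, e⟩}`, `ν = (n-1, …, 0)` (`= δ^{1/2}|det|^{(n-1)/2}`); [Macdonald1995] Ch. V §3 (3.2)–(3.4) (the same for `GL_n` of a
local field).  Nothing new is claimed: this file is the dictionary.

## What is formalised (`F` a field with `ValuativeRel F`, `𝒪[F]` a DVR, `ϖ` a uniformiser)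

* §1 **`unipotentTorusGL hϖ0 ≤ GL_n(F)`**, the subgroup `N·A = {u · ϖ^m : u upper unitriangular, m ∈ ℤⁿ}` (closed under products
  by `ϖ^m u ϖ^{-m} ∈ N`), `unipotent_mul_zpowDiagGL_mem`, `upperUnitriangular_le_unipotentTorusGL`, `zpowDiagGL_mem_unipotentTorusGL`.
* §2 **`isIwasawaExponent_gl hϖ : IsIwasawaExponent (unipotentTorusGL _) (glInt n F) (iwasawaExp hϖ)`** (from
  `iwasawaExp_mul_of_mem_glInt`, `iwasawaExp_unipotent_mul_zpowDiagGL_mul`, `exists_unipotent_mul_zpowDiagGL_mul_glInt`),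
  `iwasawaExp_of_mem_unipotentTorusGL` (`e(u ϖ^m) = m`).
* §3 **`satakeWeightHom q hq : Multiplicative ℤⁿ →* ℂ`**, `a ↦ q^{-⟨ν, a⟩}` (`satakeWeight` as a homomorphism for `q ≠ 0`).
* §4 **`satakeVec_eq_isIwasawaExponent_satakeVec`**, **`satakeTransform_eq_isIwasawaExponent_satakeTransform`** — the `GL_n`
  transform IS the abstract transform of the datum; corollaries transported from the abstract file:
  `satakeTransform_eq_monomialTwist_comp_gl` (`𝒮 = twist ∘ 𝒮_1`), `coeff_satakeTransform_doubleCosetOperator_gl`.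

## References
* [CartierCorvallis1979] P. Cartier, *Representations of 𝔭-adic groups: a survey*, PSPM 33.1 (1979), §IV (4.2), Thm. 4.1.
* [Macdonald1995] I. G. Macdonald, *Symmetric Functions and Hall Polynomials*, 2nd ed. (1995), Ch. V §3 (3.2)–(3.4).
-/

noncomputable section

open scoped MatrixGroups
open ValuativeRel Matrix Finset MonoidAlgebra Representation

namespace Literature.NumberTheory.Automorphic

variable {F : Type*} [Field F] {n : ℕ}

/-! ## §1 The subgroup `N·A = {u ϖ^m}` (no valuation needed) -/

/-- **The subgroup `N·A ≤ GL_n(F)`** of products `u · ϖ^m`, `u` upper unitriangular, `m ∈ ℤⁿ` (`ϖ^m = zpowDiagGL`): the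
`P = AN` of Cartier's `G = PK` with the torus restricted to the lattice `ϖ^{ℤⁿ} ≅ Λ`. [cite: CartierCorvallis1979, §IV (4.2)] -/
def unipotentTorusGL {ϖ : F} (hϖ0 : ϖ ≠ 0) : Subgroup (GL (Fin n) F) where
  carrier := {g | ∃ u ∈ upperUnitriangular (Fin n) F, ∃ m : Fin n → ℤ, g = u * zpowDiagGL hϖ0 m}
  one_mem' := ⟨1, (upperUnitriangular (Fin n) F).one_mem, 0, by rw [zpowDiagGL_zero, mul_one]⟩
  mul_mem' := by
    rintro _ _ ⟨u, hu, m, rfl⟩ ⟨u', hu', m', rfl⟩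
    refine ⟨u * (zpowDiagGL hϖ0 m * u' * (zpowDiagGL hϖ0 m)⁻¹),
      (upperUnitriangular (Fin n) F).mul_mem hu (zpowDiagGL_mul_mul_inv_mem_upperUnitriangular hϖ0 m hu'), m + m', ?_⟩
    rw [zpowDiagGL_add]
    group
  inv_mem' := by
    rintro _ ⟨u, hu, m, rfl⟩
    refine ⟨zpowDiagGL hϖ0 (-m) * u⁻¹ * (zpowDiagGL hϖ0 (-m))⁻¹,
      zpowDiagGL_mul_mul_inv_mem_upperUnitriangular hϖ0 (-m) ((upperUnitriangular (Fin n) F).inv_mem hu), -m, ?_⟩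
    rw [zpowDiagGL_neg]
    group

/-- `u ϖ^m ∈ N·A`. [cite: CartierCorvallis1979, §IV (4.2)] -/
theorem unipotent_mul_zpowDiagGL_mem {ϖ : F} (hϖ0 : ϖ ≠ 0) {u : GL (Fin n) F} (hu : u ∈ upperUnitriangular (Fin n) F)
    (m : Fin n → ℤ) : u * zpowDiagGL hϖ0 m ∈ unipotentTorusGL hϖ0 :=
  ⟨u, hu, m, rfl⟩

/-- Membership in `N·A`. [cite: CartierCorvallis1979, §IV (4.2)] -/
theorem mem_unipotentTorusGL_iff {ϖ : F} (hϖ0 : ϖ ≠ 0) {g : GL (Fin n) F} :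
    g ∈ unipotentTorusGL hϖ0 ↔ ∃ u ∈ upperUnitriangular (Fin n) F, ∃ m : Fin n → ℤ, g = u * zpowDiagGL hϖ0 m :=
  Iff.rfl

/-- `N ≤ N·A`. [cite: CartierCorvallis1979, §IV (4.2)] -/
theorem upperUnitriangular_le_unipotentTorusGL {ϖ : F} (hϖ0 : ϖ ≠ 0) :
    upperUnitriangular (Fin n) F ≤ unipotentTorusGL hϖ0 := fun u hu =>
  ⟨u, hu, 0, by rw [zpowDiagGL_zero, mul_one]⟩

/-- `ϖ^m ∈ N·A`. [cite: CartierCorvallis1979, §IV (4.2)] -/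
theorem zpowDiagGL_mem_unipotentTorusGL {ϖ : F} (hϖ0 : ϖ ≠ 0) (m : Fin n → ℤ) : zpowDiagGL hϖ0 m ∈ unipotentTorusGL hϖ0 :=
  ⟨1, (upperUnitriangular (Fin n) F).one_mem, m, by rw [one_mul]⟩

/-! ## §2 The Iwasawa datum of `GL_n(F)` -/

section Iwasawa

variable [ValuativeRel F] [IsDiscreteValuationRing 𝒪[F]] {ϖ : F}

/-- `e(u ϖ^m) = m` for `u ∈ N`. [cite: CartierCorvallis1979, §IV (4.2)] -/
theorem iwasawaExp_unipotent_mul_zpowDiagGL (hϖ : IsUniformizingElement ϖ) {u : GL (Fin n) F}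
    (hu : u ∈ upperUnitriangular (Fin n) F) (m : Fin n → ℤ) : iwasawaExp hϖ (u * zpowDiagGL hϖ.ne_zero m) = m :=
  iwasawaExp_eq hϖ hu (glInt n F).one_mem (mul_one _).symm

/-- **THE IWASAWA DATUM OF `GL_n(F)`**: `iwasawaExp hϖ` is an Iwasawa exponent for `(N·A, GL_n(𝒪))` — right `GL_n(𝒪)`-invariant
(`iwasawaExp_mul_of_mem_glInt`), left `N·A`-additive (`iwasawaExp_unipotent_mul_zpowDiagGL_mul`), `G = N A K`
(`exists_unipotent_mul_zpowDiagGL_mul_glInt`). [cite: CartierCorvallis1979, §IV (4.2)] -/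
theorem isIwasawaExponent_gl (hϖ : IsUniformizingElement ϖ) :
    IsIwasawaExponent (unipotentTorusGL (n := n) hϖ.ne_zero) (glInt n F) (iwasawaExp hϖ) where
  mul_of_mem_right g _ hk := iwasawaExp_mul_of_mem_glInt hϖ g hk
  mul_of_mem_left := by
    rintro _ ⟨u, hu, m, rfl⟩ g
    rw [iwasawaExp_unipotent_mul_zpowDiagGL_mul hϖ hu m g, iwasawaExp_unipotent_mul_zpowDiagGL hϖ hu m]
  exists_eq_mul g := by
    obtain ⟨u, hu, m, k, hk, h⟩ := exists_unipotent_mul_zpowDiagGL_mul_glInt hϖ g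
    exact ⟨u * zpowDiagGL hϖ.ne_zero m, unipotent_mul_zpowDiagGL_mem hϖ.ne_zero hu m, k, hk, h⟩

/-- `e(p) = m` for `p = u ϖ^m ∈ N·A` read through the membership witness. [cite: CartierCorvallis1979, §IV (4.2)] -/
theorem iwasawaExp_of_mem_unipotentTorusGL (hϖ : IsUniformizingElement ϖ) {p : GL (Fin n) F}
    (hp : p ∈ unipotentTorusGL hϖ.ne_zero) : iwasawaExp hϖ p = hp.choose_spec.2.choose := by
  obtain ⟨hu, m, h⟩ := hp.choose_spec
  conv_lhs => rw [hp.choose_spec.2.choose_spec]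
  exact iwasawaExp_unipotent_mul_zpowDiagGL hϖ hp.choose_spec.1 _

end Iwasawa

/-! ## §3 The weight `q^{-⟨ν, ·⟩}` as a homomorphism -/

/-- **`satakeWeight q` as a homomorphism `Multiplicative ℤⁿ →* ℂ`**, `a ↦ q^{-⟨ν, a⟩}` (`q ≠ 0`).
[cite: CartierCorvallis1979, §IV (4.2)] -/
def satakeWeightHom (q : ℂ) (hq : q ≠ 0) : Multiplicative (Fin n → ℤ) →* ℂ where
  toFun a := satakeWeight q a.toAdd
  map_one' := satakeWeight_zero q
  map_mul' a b := satakeWeight_add hq a.toAdd b.toAdd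

/-- `satakeWeightHom q hq (ofAdd e) = satakeWeight q e`. [cite: CartierCorvallis1979, §IV (4.2)] -/
@[simp] theorem satakeWeightHom_ofAdd (q : ℂ) (hq : q ≠ 0) (e : Fin n → ℤ) :
    satakeWeightHom q hq (Multiplicative.ofAdd e) = satakeWeight q e :=
  rfl

/-! ## §4 The `GL_n` transform is the abstract transform -/

section Bridge

variable [ValuativeRel F] [IsDiscreteValuationRing 𝒪[F]] {ϖ : F} (hϖ : IsUniformizingElement ϖ) [Finite 𝓀[F]]
include hϖ

/-- **`satakeVec hϖ = IsIwasawaExponent.satakeVec`** for the `GL_n` datum and the weight `q^{-⟨ν,·⟩}`, `q = #𝓀`.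
[cite: CartierCorvallis1979, §IV (4.2)] -/
theorem satakeVec_eq_isIwasawaExponent_satakeVec :
    satakeVec (n := n) hϖ = IsIwasawaExponent.satakeVec (glInt n F) (iwasawaExp hϖ)
      (satakeWeightHom (Nat.card 𝓀[F] : ℂ) natCard_residueField_ne_zero) := by
  refine LinearMap.ext fun x => ?_
  rw [satakeVec_apply, IsIwasawaExponent.satakeVec_apply]
  rfl

/-- **THE `GL_n` SATAKE TRANSFORM IS THE ABSTRACT ONE**: `satakeTransform hϖ = (isIwasawaExponent_gl hϖ).satakeTransform w`
with `w = q^{-⟨ν, ·⟩}`. [cite: CartierCorvallis1979, §IV (4.2), Thm. 4.1] -/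
theorem satakeTransform_eq_isIwasawaExponent_satakeTransform :
    satakeTransform (n := n) hϖ = (isIwasawaExponent_gl hϖ).satakeTransform
      (satakeWeightHom (Nat.card 𝓀[F] : ℂ) natCard_residueField_ne_zero) := by
  refine AlgHom.ext fun T => ?_
  rw [satakeTransform_apply, IsIwasawaExponent.satakeTransform_apply, satakeVec_eq_isIwasawaExponent_satakeVec]

/-- Transported: **`𝒮 = monomialTwist (q^{-⟨ν,·⟩}) ∘ 𝒮_1`** (the `GL_n` transform is a twist of the counting transform of its
datum). [cite: CartierCorvallis1979, §IV (4.2)] -/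
theorem satakeTransform_eq_monomialTwist_comp_gl :
    satakeTransform (n := n) hϖ =
      (monomialTwist (satakeWeightHom (Nat.card 𝓀[F] : ℂ) natCard_residueField_ne_zero)).comp
        ((isIwasawaExponent_gl hϖ).satakeTransform 1) := by
  rw [satakeTransform_eq_isIwasawaExponent_satakeTransform]
  exact (isIwasawaExponent_gl hϖ).satakeTransform_eq_monomialTwist_comp _

variable [IsHeckeTriple (⊤ : Submonoid (GL (Fin n) F)) (glInt n F) (glInt n F)]

/-- Transported **coefficient formula**: the coefficient of `x^μ` in `𝒮(T_g)` is `#{α ∈ KgK/K : e(α) = μ} · q^{-⟨ν, μ⟩}`.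
[cite: CartierCorvallis1979, §IV (4.2)] -/
theorem coeff_satakeTransform_doubleCosetOperator_gl (g : GL (Fin n) F) (μ : Fin n → ℤ)
    [DecidablePred fun α : GL (Fin n) F ⧸ glInt n F => iwasawaExp hϖ α.out = μ] :
    (satakeTransform hϖ (heckeAlgebra.doubleCosetOperator (glInt n F) g)).coeff μ =
      (((finite_orbit_quotient (glInt n F) g).toFinset.filter fun α => iwasawaExp hϖ α.out = μ).card : ℂ) *
        satakeWeight (Nat.card 𝓀[F] : ℂ) μ := by
  rw [satakeTransform_eq_isIwasawaExponent_satakeTransform, IsIwasawaExponent.coeff_satakeTransform_doubleCosetOperator,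
    satakeWeightHom_ofAdd]

/-- Transported **vanishing**: `x^μ` does not occur in `𝒮(T_g)` unless some `α ∈ KgK/K` has `e(α) = μ`.
[cite: CartierCorvallis1979, §IV (4.2)] -/
theorem coeff_satakeTransform_doubleCosetOperator_gl_eq_zero {g : GL (Fin n) F} {μ : Fin n → ℤ}
    (h : ∀ α : GL (Fin n) F ⧸ glInt n F, α ∈ MulAction.orbit (glInt n F) (g : GL (Fin n) F ⧸ glInt n F) →
      iwasawaExp hϖ α.out ≠ μ) :
    (satakeTransform hϖ (heckeAlgebra.doubleCosetOperator (glInt n F) g)).coeff μ = 0 := by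
  rw [satakeTransform_eq_isIwasawaExponent_satakeTransform]
  exact (isIwasawaExponent_gl hϖ).coeff_satakeTransform_doubleCosetOperator_eq_zero _ h

end Bridge

end Literature.NumberTheory.Automorphic

end
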